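import Summits.BirchSwinnertonDyer.BirchSwinnertonDyer.Theorems.PrintCFramBottomClassIndexLawFiveLeThetaCycleLegendreAtP
import Literature.NumberTheory.ModularForms.ModPModularFormsThetaFiltration
import HarnessLib

/-!
# Crux `PrintCFram.BottomClassIndexLawFiveLe` (stmt-BirchSwinnertonDyer-20372), line `eisenstein-resource-bdp-line` (registry v23):
# THE KATZ FAMILY OF (CutForm⁶) IS `M̃_•(N; 𝔽_p)` — the `∃ 𝔽 ι M w Θ` prefix of `stub_cutForm` discharged into three cite-tagged facts
# (cell `bsd-print-cfram`, width seat `bsd-line-cfram-p1-w6` g6; THEOREMS ONLY, `--supports` 20372; BSD is not proved by any of this)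

HONEST FRAMING. Nothing here is a statement about elliptic curves or BSD beyond plumbing; no registered stub is closed. Registry v23
(LEAD g13) carries `stub_cutForm` = (CutForm⁶) (the `hcut` binder of `ThetaCycle.atP_six_of_cutForm`, p686877): for every class
datum and auxiliary `(r, e)` there EXIST a field `𝔽` of characteristic `p`, `ι : ℤ_p → 𝔽`, a family `M j ⊆ 𝔽⟦q⟧` with filtration `w`
and operator `Θ` satisfying the five Katz hypotheses (`hfil`, `hfil_mem`, `hM0`, `hΘ_mem`, `hKatz`), and `q`-series `G`, `T` with the
cut-form properties. w8 g6's typing memo (`Lines/eisenstein-resource-bdp-line-w8g6-notes.md` §3.2) splits this into four named facts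
NF-A (Cohen), NF-B (`θ₀²`), NF-C (periodic cut), NF-D (the Katz family) plus glue. THIS FILE DISCHARGES THE NF-D SLOT STRUCTURALLY:
the family is now a DEFINITION of the tree — `Literature.NumberTheory.ModularForms.ModP.modPForms p N j` = Jochnowitz's `M̃_j(N)`,
the reductions mod `p` of the `q`-expansions at `∞` of forms in Mathlib's `ModularForm (Gamma1 N) j` with rational `p`-integral
coefficients, with `filtration` (`Nat.find`) and `theta` (`Σ aₙqⁿ ↦ Σ n aₙqⁿ`), `𝔽 := ZMod p`, `ι := PadicInt.toZMod` — and of the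
five hypotheses, `hfil_mem`, `w ≤ j` and `hM0` (weight `0` = constants, via Mathlib's `ModularForm.eq_const_of_weight_zero`) are
THEOREMS, while the three printed theorems are statement-only cite-tagged facts of `Literature/…/ModPModularFormsThetaFiltration.lean`:
`ModP.WeightCongruence p N` (weights of congruent forms are `≡ (mod p−1)`: [Jochnowitz1982 §1 p. 270], [Gross1990 Prop. 4.9],
[Katz1973 §4.4]), `ModP.ThetaMem p N` (`θ : M̃_k → M̃_{k+p+1}`: [Katz1977 Thm. (1), Cor. (1)], [Jochnowitz1982 Fact 1.4]),
`ModP.ThetaFiltration p N` (`p ∤ w(f) ⟹ w(θf) = w(f)+p+1`: [Katz1977 Thm. (2)], [Gross1990 Prop. 4.10 (a)], [Jochnowitz1982 Facts 1.4/5.2]).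

* `cutForm_six_of_modP` — **(CutForm⁶) ⟸ Facts A ∧ B ∧ C (at every level prime to `p`) ∧ (CutFormModP⁶)**, where (CutFormModP⁶) is
  (CutForm⁶) with the existential prefix INSTANTIATED: per class datum and `(r, e)`, a level `N ≥ 1` with `p ∤ N` and two `q`-series
  `G T ∈ 𝔽_p⟦q⟧` with `G·T ∈ M̃_{k+(p+1)/2}(N)`, `T ≠ 0` supported on `pℕ`, `G` supported on the `m`-cut, and the Cohen dictionary
  `coeff (m n₀ f²) G = t · (x mod p)` — i.e. exactly what NF-A/NF-B/NF-C + D1/D5 glue must deliver, and nothing about Katz's theory.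
* `atP_six_of_modP` — registry v21–v23's `stub_atP` conclusion VERBATIM ⟸ the same hypotheses (composition with `atP_six_of_cutForm`;
  that it typechecks certifies that `cutForm_six_of_modP` concludes the registered (CutForm⁶) text byte for byte).
beyond-print theorem: NO. BSD is not proved by any of this; the crux is OPEN and not claimed false; (CutFormModP⁶) and the three facts
are NOT discharged here.

References: [Jochnowitz1982] §1 Def. 1.1–1.2, Fact 1.4, §5 Fact 5.2; [Katz1977] Thm. (1)–(2); [Gross1990] §4 Props. 4.9–4.10;
[Katz1973] §§1.6–1.7, 4.4; [Cohen1975] Thm. 3.1; crux notes `Lines/eisenstein-resource-bdp-line-w8g6-notes.md` §3.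
-/

set_option autoImplicit false
-- summit-side namespace `Summit.BirchSwinnertonDyer.BirchSwinnertonDyer.…` (single-conjunct summit, D-0017 layout)
set_option linter.dupNamespace false

noncomputable section

open scoped Classical NumberTheorySymbols
open NumberField WeierstrassCurve DirichletCharacter Literature.NumberTheory.LFunctions
  Literature.NumberTheory.EllipticCurves Literature.NumberTheory.EllipticCurves.KrizLi2019
  Literature.NumberTheory.EllipticCurves.Rank1Residual Literature.NumberTheory.QuadraticFields

namespace Summit.BirchSwinnertonDyer.BirchSwinnertonDyer.Theorems.PrintCFram.ThetaCycle

open Summit.BirchSwinnertonDyer.BirchSwinnertonDyer.Theorems.PrintCFram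
open Summit.BirchSwinnertonDyer.BirchSwinnertonDyer.Theorems
open PowerSeries
open Literature.NumberTheory.ModularForms.ModP

/-! ## §11 (CutForm⁶) with its Katz family instantiated by `M̃_•(N; 𝔽_p)` -/

/-- **(CutForm⁶) ⟸ Katz's three theorems (named facts A, B, C of `ModP`, at every level prime to `p`) ∧ (CutFormModP⁶).**
(CutFormModP⁶) = `hmodP`: for each class datum `(p, m, χ, k)` at the six leaf primes and auxiliary `(r, e)`, a level `N ≠ 0` with
`p ∤ N` and `G T : 𝔽_p⟦q⟧` with `G·T ∈ M̃_{k+(p+1)/2}(N)` (`ModP.modPForms`, reductions of rational `p`-integral `q`-expansions at `∞` of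
forms on `Γ₁(N)`), `T ≠ 0` supported on multiples of `p`, `G` supported on the `m`-cut, and the dictionary `coeff (m n₀ f²) G =
t · (x mod p)` with `x = k⁻¹ B_{k,(χ↑ε_K↑)~} ∈ ℤ_p` — the (CutForm⁶) text with `𝔽 := ZMod p`, `ι := PadicInt.toZMod`,
`M := modPForms p N`, `w := filtration p N`, `Θ := theta (ZMod p)`. The five Katz hypotheses are supplied by `ModP.katzHypotheses`
(`hfil_mem`, `w ≤ j`, `hM0` proved; `hfil`'s congruence, `hΘ_mem`, `hKatz` from the facts). Nothing discharged; nothing about BSD.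
[Katz1977, Thm. (1)–(2)] [Jochnowitz1982, §1 Fact 1.4] [Gross1990, Props. 4.9–4.10] [Cohen1975, Thm. 3.1] -/
theorem cutForm_six_of_modP
    (hA : ∀ (p : ℕ) [Fact p.Prime] (N : ℕ), WeightCongruence p N)
    (hB : ∀ (p : ℕ) [Fact p.Prime] (N : ℕ), ThetaMem p N)
    (hC : ∀ (p : ℕ) [Fact p.Prime] (N : ℕ), ThetaFiltration p N)
    (hmodP : ∀ (p : ℕ) [Fact p.Prime] (m : ℕ) [NeZero m] (χ : DirichletCharacter ℚ_[p] m) (k : ℕ),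
      (p = 7 ∨ p = 11 ∨ p = 19 ∨ p = 43 ∨ p = 67 ∨ p = 163) →
      m.Coprime p → χ.IsPrimitive → χ.IsQuadratic → (k = (p + 1) / 4 ∨ k = (3 * p - 1) / 4) →
      2 ≤ k → k ≤ p - 2 → χ (-1) * (-1) ^ k = -1 →
      ∀ (r e : ℕ), r.Prime → r ≠ 2 → r ≠ p → e ≤ 1 →
      ∃ (N : ℕ) (G T : PowerSeries (ZMod p)), N ≠ 0 ∧ ¬ p ∣ N ∧
        G * T ∈ modPForms p N (k + (p + 1) / 2) ∧ T ≠ 0 ∧ (∀ j : ℕ, coeff j T ≠ 0 → p ∣ j) ∧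
        (∀ a : ℕ, coeff a G ≠ 0 →
          m ∣ a ∧ a / m % 4 = 3 ∧ (∀ q : ℕ, q.Prime → q ∣ m → q ≠ 2 → jacobiSym (-((a / m : ℕ) : ℤ)) q = 1) ∧
            (2 ∣ m → a / m % 8 = 7) ∧ r ^ e ∣ a / m ∧ ¬ r ^ (e + 1) ∣ a / m) ∧
        (∀ (n₀ f : ℕ) (K : Type) [Field K] [NumberField K] (εK : DirichletCharacter ℚ_[p] (NumberField.discr K).natAbs),
          Squarefree n₀ → n₀ % 4 = 3 → 0 < f →
          (m ∣ m * (n₀ * f ^ 2) ∧ m * (n₀ * f ^ 2) / m % 4 = 3 ∧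
            (∀ q : ℕ, q.Prime → q ∣ m → q ≠ 2 → jacobiSym (-((m * (n₀ * f ^ 2) / m : ℕ) : ℤ)) q = 1) ∧
            (2 ∣ m → m * (n₀ * f ^ 2) / m % 8 = 7) ∧ r ^ e ∣ m * (n₀ * f ^ 2) / m ∧
            ¬ r ^ (e + 1) ∣ m * (n₀ * f ^ 2) / m) →
          IsImaginaryQuadratic K → NumberField.discr K = -(n₀ : ℤ) → IsKroneckerCharacterOf K εK →
          ∃ (t : ℤ) (x : ℤ_[p]), (f = 1 → t = 1) ∧
            (x : ℚ_[p]) = (k : ℚ_[p])⁻¹ * @generalizedBernoulli ℚ_[p] _ _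
              (changeLevel (dvd_mul_right m (NumberField.discr K).natAbs) χ *
                changeLevel (dvd_mul_left (NumberField.discr K).natAbs m) εK).conductor ⟨conductor_ne_zero _⟩ k
              (changeLevel (dvd_mul_right m (NumberField.discr K).natAbs) χ *
                changeLevel (dvd_mul_left (NumberField.discr K).natAbs m) εK).primitiveCharacter ∧
            coeff (m * (n₀ * f ^ 2)) G = (t : ZMod p) * PadicInt.toZMod x)) :
    ∀ (p : ℕ) [Fact p.Prime] (m : ℕ) [NeZero m] (χ : DirichletCharacter ℚ_[p] m) (k : ℕ),
      (p = 7 ∨ p = 11 ∨ p = 19 ∨ p = 43 ∨ p = 67 ∨ p = 163) →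
      m.Coprime p → χ.IsPrimitive → χ.IsQuadratic → (k = (p + 1) / 4 ∨ k = (3 * p - 1) / 4) →
      2 ≤ k → k ≤ p - 2 → χ (-1) * (-1) ^ k = -1 →
      ∀ (r e : ℕ), r.Prime → r ≠ 2 → r ≠ p → e ≤ 1 →
      ∃ (𝔽 : Type) (_ : Field 𝔽) (_ : CharP 𝔽 p) (ι : ℤ_[p] →+* 𝔽)
        (M : ℕ → Submodule 𝔽 (PowerSeries 𝔽)) (w : PowerSeries 𝔽 → ℕ) (Θ : PowerSeries 𝔽 →ₗ[𝔽] PowerSeries 𝔽)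
        (G T : PowerSeries 𝔽),
        (∀ (g : PowerSeries 𝔽) (n : ℕ), coeff n (Θ g) = (n : 𝔽) * coeff n g) ∧
        (∀ (g : PowerSeries 𝔽) (j : ℕ), g ∈ M j → g ≠ 0 → w g ≤ j ∧ (p - 1) ∣ (j - w g)) ∧
        (∀ (g : PowerSeries 𝔽) (j : ℕ), g ∈ M j → g ≠ 0 → g ∈ M (w g)) ∧
        (∀ g ∈ M 0, g = C (constantCoeff g)) ∧
        (∀ (g : PowerSeries 𝔽) (j : ℕ), g ∈ M j → Θ g ∈ M (j + p + 1)) ∧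
        (∀ (g : PowerSeries 𝔽) (j : ℕ), g ∈ M j → g ≠ 0 → ¬ p ∣ w g → Θ g ≠ 0 ∧ w (Θ g) = w g + p + 1) ∧
        G * T ∈ M (k + (p + 1) / 2) ∧ T ≠ 0 ∧ (∀ j : ℕ, coeff j T ≠ 0 → p ∣ j) ∧
        (∀ a : ℕ, coeff a G ≠ 0 →
          m ∣ a ∧ a / m % 4 = 3 ∧ (∀ q : ℕ, q.Prime → q ∣ m → q ≠ 2 → jacobiSym (-((a / m : ℕ) : ℤ)) q = 1) ∧
            (2 ∣ m → a / m % 8 = 7) ∧ r ^ e ∣ a / m ∧ ¬ r ^ (e + 1) ∣ a / m) ∧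
        (∀ (n₀ f : ℕ) (K : Type) [Field K] [NumberField K] (εK : DirichletCharacter ℚ_[p] (NumberField.discr K).natAbs),
          Squarefree n₀ → n₀ % 4 = 3 → 0 < f →
          (m ∣ m * (n₀ * f ^ 2) ∧ m * (n₀ * f ^ 2) / m % 4 = 3 ∧
            (∀ q : ℕ, q.Prime → q ∣ m → q ≠ 2 → jacobiSym (-((m * (n₀ * f ^ 2) / m : ℕ) : ℤ)) q = 1) ∧
            (2 ∣ m → m * (n₀ * f ^ 2) / m % 8 = 7) ∧ r ^ e ∣ m * (n₀ * f ^ 2) / m ∧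
            ¬ r ^ (e + 1) ∣ m * (n₀ * f ^ 2) / m) →
          IsImaginaryQuadratic K → NumberField.discr K = -(n₀ : ℤ) → IsKroneckerCharacterOf K εK →
          ∃ (t : ℤ) (x : ℤ_[p]), (f = 1 → t = 1) ∧
            (x : ℚ_[p]) = (k : ℚ_[p])⁻¹ * @generalizedBernoulli ℚ_[p] _ _
              (changeLevel (dvd_mul_right m (NumberField.discr K).natAbs) χ *
                changeLevel (dvd_mul_left (NumberField.discr K).natAbs m) εK).conductor ⟨conductor_ne_zero _⟩ k
              (changeLevel (dvd_mul_right m (NumberField.discr K).natAbs) χ *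
                changeLevel (dvd_mul_left (NumberField.discr K).natAbs m) εK).primitiveCharacter ∧
            coeff (m * (n₀ * f ^ 2)) G = (t : 𝔽) * ι x) := by
  intro p _ m _ χ k hp6 hmp hχ hχq hk hk2 hkp hpar r e hr hr2 hrp he
  obtain ⟨N, G, T, hN0, hpN, hGT, hT0, hTsupp, hGsupp, hdict⟩ :=
    hmodP p m χ k hp6 hmp hχ hχq hk hk2 hkp hpar r e hr hr2 hrp he
  haveI : NeZero N := ⟨hN0⟩
  have h5 : 5 ≤ p := by rcases hp6 with h | h | h | h | h | h <;> omega
  obtain ⟨h1, h2, h3, h4, h5', h6⟩ := katzHypotheses p N (hA p N) (hB p N) (hC p N) h5 hpN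
  exact ⟨ZMod p, inferInstance, inferInstance, PadicInt.toZMod, modPForms p N, filtration p N, theta (ZMod p), G, T,
    h1, h2, h3, h4, h5', h6, hGT, hT0, hTsupp, hGsupp, hdict⟩

/-! ## §12 `stub_atP` from the facts and (CutFormModP⁶) — certifies the verbatim match with the registered (CutForm⁶) -/

/-- **Registry v21–v23's `stub_atP` conclusion (VERBATIM) ⟸ Facts A ∧ B ∧ C ∧ (CutFormModP⁶)** — `atP_six_of_cutForm` (p686877)
composed with `cutForm_six_of_modP`; that this one-liner typechecks certifies that `cutForm_six_of_modP` concludes the registered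
(CutForm⁶) text (= v23's `stub_cutForm`) byte for byte. Nothing discharged; nothing about BSD.
[Katz1977, Thm. (1)–(2)] [Cohen1975, Thm. 3.1] [AhlgrenBoylan2003, Thm. 3] -/
theorem atP_six_of_modP
    (hA : ∀ (p : ℕ) [Fact p.Prime] (N : ℕ), WeightCongruence p N)
    (hB : ∀ (p : ℕ) [Fact p.Prime] (N : ℕ), ThetaMem p N)
    (hC : ∀ (p : ℕ) [Fact p.Prime] (N : ℕ), ThetaFiltration p N)
    (hmodP : ∀ (p : ℕ) [Fact p.Prime] (m : ℕ) [NeZero m] (χ : DirichletCharacter ℚ_[p] m) (k : ℕ),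
      (p = 7 ∨ p = 11 ∨ p = 19 ∨ p = 43 ∨ p = 67 ∨ p = 163) →
      m.Coprime p → χ.IsPrimitive → χ.IsQuadratic → (k = (p + 1) / 4 ∨ k = (3 * p - 1) / 4) →
      2 ≤ k → k ≤ p - 2 → χ (-1) * (-1) ^ k = -1 →
      ∀ (r e : ℕ), r.Prime → r ≠ 2 → r ≠ p → e ≤ 1 →
      ∃ (N : ℕ) (G T : PowerSeries (ZMod p)), N ≠ 0 ∧ ¬ p ∣ N ∧
        G * T ∈ modPForms p N (k + (p + 1) / 2) ∧ T ≠ 0 ∧ (∀ j : ℕ, coeff j T ≠ 0 → p ∣ j) ∧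
        (∀ a : ℕ, coeff a G ≠ 0 →
          m ∣ a ∧ a / m % 4 = 3 ∧ (∀ q : ℕ, q.Prime → q ∣ m → q ≠ 2 → jacobiSym (-((a / m : ℕ) : ℤ)) q = 1) ∧
            (2 ∣ m → a / m % 8 = 7) ∧ r ^ e ∣ a / m ∧ ¬ r ^ (e + 1) ∣ a / m) ∧
        (∀ (n₀ f : ℕ) (K : Type) [Field K] [NumberField K] (εK : DirichletCharacter ℚ_[p] (NumberField.discr K).natAbs),
          Squarefree n₀ → n₀ % 4 = 3 → 0 < f →
          (m ∣ m * (n₀ * f ^ 2) ∧ m * (n₀ * f ^ 2) / m % 4 = 3 ∧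
            (∀ q : ℕ, q.Prime → q ∣ m → q ≠ 2 → jacobiSym (-((m * (n₀ * f ^ 2) / m : ℕ) : ℤ)) q = 1) ∧
            (2 ∣ m → m * (n₀ * f ^ 2) / m % 8 = 7) ∧ r ^ e ∣ m * (n₀ * f ^ 2) / m ∧
            ¬ r ^ (e + 1) ∣ m * (n₀ * f ^ 2) / m) →
          IsImaginaryQuadratic K → NumberField.discr K = -(n₀ : ℤ) → IsKroneckerCharacterOf K εK →
          ∃ (t : ℤ) (x : ℤ_[p]), (f = 1 → t = 1) ∧
            (x : ℚ_[p]) = (k : ℚ_[p])⁻¹ * @generalizedBernoulli ℚ_[p] _ _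
              (changeLevel (dvd_mul_right m (NumberField.discr K).natAbs) χ *
                changeLevel (dvd_mul_left (NumberField.discr K).natAbs m) εK).conductor ⟨conductor_ne_zero _⟩ k
              (changeLevel (dvd_mul_right m (NumberField.discr K).natAbs) χ *
                changeLevel (dvd_mul_left (NumberField.discr K).natAbs m) εK).primitiveCharacter ∧
            coeff (m * (n₀ * f ^ 2)) G = (t : ZMod p) * PadicInt.toZMod x)) :
    ∀ (p : ℕ) [Fact p.Prime] (m : ℕ) [NeZero m] (χ : DirichletCharacter ℚ_[p] m) (k : ℕ),
      (p = 7 ∨ p = 11 ∨ p = 19 ∨ p = 43 ∨ p = 67 ∨ p = 163) →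
      m.Coprime p → χ.IsPrimitive → χ.IsQuadratic → (k = (p + 1) / 4 ∨ k = (3 * p - 1) / 4) →
      2 ≤ k → k ≤ p - 2 → χ (-1) * (-1) ^ k = -1 →
      (∃ (K₀ : Type) (_ : Field K₀) (_ : NumberField K₀) (ε₀ : DirichletCharacter ℚ_[p] (NumberField.discr K₀).natAbs),
        IsImaginaryQuadratic K₀ ∧
        (∀ q : ℕ, q.Prime → q ∣ m → ((Ideal.span {(q : ℤ)}).primesOver (𝓞 K₀)).ncard = 2) ∧
        Odd (NumberField.discr K₀) ∧ NumberField.discr K₀ < -4 ∧ IsKroneckerCharacterOf K₀ ε₀ ∧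
        ¬ ‖(k : ℚ_[p])⁻¹ * @generalizedBernoulli ℚ_[p] _ _
            (changeLevel (dvd_mul_right m (NumberField.discr K₀).natAbs) χ *
              changeLevel (dvd_mul_left (NumberField.discr K₀).natAbs m) ε₀).conductor ⟨conductor_ne_zero _⟩ k
            (changeLevel (dvd_mul_right m (NumberField.discr K₀).natAbs) χ *
              changeLevel (dvd_mul_left (NumberField.discr K₀).natAbs m) ε₀).primitiveCharacter‖ ≤ (p : ℝ)⁻¹) →
      ∃ (K : Type) (_ : Field K) (_ : NumberField K) (εK : DirichletCharacter ℚ_[p] (NumberField.discr K).natAbs),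
        IsImaginaryQuadratic K ∧
        (∀ q : ℕ, q.Prime → q ∣ p * m → ((Ideal.span {(q : ℤ)}).primesOver (𝓞 K)).ncard = 2) ∧
        Odd (NumberField.discr K) ∧ NumberField.discr K < -4 ∧ IsKroneckerCharacterOf K εK ∧
        ¬ ‖(k : ℚ_[p])⁻¹ * @generalizedBernoulli ℚ_[p] _ _
            (changeLevel (dvd_mul_right m (NumberField.discr K).natAbs) χ *
              changeLevel (dvd_mul_left (NumberField.discr K).natAbs m) εK).conductor ⟨conductor_ne_zero _⟩ k
            (changeLevel (dvd_mul_right m (NumberField.discr K).natAbs) χ *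
              changeLevel (dvd_mul_left (NumberField.discr K).natAbs m) εK).primitiveCharacter‖ ≤ (p : ℝ)⁻¹ :=
  atP_six_of_cutForm (cutForm_six_of_modP hA hB hC hmodP)

end Summit.BirchSwinnertonDyer.BirchSwinnertonDyer.Theorems.PrintCFram.ThetaCycle
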